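import Mathlib
import Summits.SmoothPoincare4.SmoothPoincare4.Theorems.ConvexBisectionAcyclicBisectionExistsMultiAttachmentHomologyMV
import Summits.SmoothPoincare4.SmoothPoincare4.Theorems.ConvexBisectionAcyclicBisectionExistsMultiAttachmentHomologyLoops
import Summits.SmoothPoincare4.SmoothPoincare4.Theorems.ConvexBisectionAcyclicBisectionExistsMultiAttachmentH1Cores
import Summits.SmoothPoincare4.SmoothPoincare4.Theorems.ConvexBisectionAcyclicBisectionExistsMultiAttachmentH1Cover
import HarnessLib

/-!
# Mayer–Vietoris over an open piece and finitely many disjoint open pieces whose `H₁` is fed by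
# the overlaps: `H₁(Y) ≅ H₁(A) ⧸ ⟨one class per piece⟩`
(helper for stub `stub_modelsOn_counts` = NF2, clause 3 = Kas' presentation of `H₁(∂X(F; l); ℤ)`;
line `modp-braid-orbits` r9, crux `ConvexBisection.AcyclicBisectionExists`, item
stmt-SmoothPoincare4-10508; wave 4 / W4-D, design lemma (D) `Kas_seam_quotient`: the Mayer–Vietoris
bookkeeping for the cover `∂X = U ∪ ⋃ᵢ Wᵢ` of the boundary of a Kosinski multi-attachment of
2-handles, where — unlike `…MultiAttachmentH1Cover.lean` (`H₁(jBᵢ(D⁴ ∖ S)) = 0`) — the pieces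
`Wᵢ ≅ S³ ∖ S` have `H₁(Wᵢ) ≅ ℤ`, fed by the meridian of the overlap `U ∩ Wᵢ ≅ T² × ℝ`.)

Hatcher 2002, §2.2 p. 149: if `φ₀ : H₀(A ∩ B) → H₀(A) ⊕ H₀(B)` is injective then `ψ₁` is onto; if
moreover `i_B : H₁(A ∩ B) → H₁(B)` is ONTO then `H₁(A) → H₁(Y)` is onto, and by exactness its kernel
is `i_A (ker i_B)`.  §1: cover of a type; §2: two open subsets of a space; §3: an open piece `A`
and finitely many disjoint open pieces `Bᵢ`; §4: the registered sub-goal stub `stub_Kas_seamMV`.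
§§1–3 adapt (and import) `…MultiAttachmentHomologyMV.lean`, `…H1Cores.lean`, `…H1Cover.lean`.
Everything is proved; no named facts, no `sorry`.  References: A. Hatcher, *Algebraic Topology*
(2002), §2.2 pp. 149–150 [HatcherAT2002]; A. Kas, Pacific J. Math. 89 (1980) [Kas1980].
-/

noncomputable section

-- the prescribed namespace `Summit.<P>.<Sub>.…` duplicates `SmoothPoincare4` (P = Sub)
set_option linter.dupNamespace false

open Set Function CategoryTheory CategoryTheory.Limits
open Literature.AlgebraicTopology.SingularHomology

namespace Summit.SmoothPoincare4.SmoothPoincare4.Theorems.AcyclicBisectionExists.ModpBraidOrbits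

universe u v

variable (R : Type v) [CommRing R] (M : Type v) [AddCommGroup M] [Module R M]

/-! ## §1 Mayer–Vietoris for a cover `Y = int A ∪ int B` whose `H(B)` is fed by `H(A ∩ B)` -/

section Cover

variable {Y : Type u} [TopologicalSpace Y] (A B : Set Y)

/-- **`ker (Hₙ(A) → Hₙ(Y)) = i_A (ker i_B)`** (exactness at `Hₙ(A) ⊕ Hₙ(B)`). [cite: HatcherAT2002, §2.2 p. 149] -/
theorem ker_map_eq_map_ker_right (hAB : interior A ∪ interior B = univ) (n : ℕ) :
    LinearMap.ker (singularHomology.map R M (subsetIncl A) n).hom =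
      Submodule.map (singularHomology.map R M
        (subsetInclusion (inter_subset_left : A ∩ B ⊆ A)) n).hom
        (LinearMap.ker (singularHomology.map R M
          (subsetInclusion (inter_subset_right : A ∩ B ⊆ B)) n).hom) := by
  set iB := singularHomology.map R M (subsetInclusion (inter_subset_right : A ∩ B ⊆ B)) n
  apply le_antisymm
  · intro a ha
    have hψ : mayerVietoris.ψ R M A B n
        ((biprod.inl : singularHomology R M A n ⟶ _ ⊞ singularHomology R M B n) a) = 0 := by
      rw [mayerVietoris.ψ, biprod_desc_inl_apply]; exact ha
    obtain ⟨c, hc⟩ := (ShortComplex.moduleCat_exact_iff _).1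
      (mayerVietoris.exact₁_holds R M A B hAB n) _ hψ
    change mayerVietoris.φ R M A B n c = _ at hc
    have h2 := congrArg (biprod.snd : singularHomology R M A n ⊞ singularHomology R M B n ⟶ _) hc
    rw [mayerVietoris.φ, biprod_snd_lift_apply, ← ModuleCat.comp_apply, biprod.inl_snd] at h2
    have hc0 : (-iB) c = 0 := h2
    rw [show (-iB) c = (-iB).hom c from rfl, ModuleCat.hom_neg, LinearMap.neg_apply,
      neg_eq_zero] at hc0
    have h1 := congrArg (biprod.fst : singularHomology R M A n ⊞ singularHomology R M B n ⟶ _) hc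
    rw [mayerVietoris.φ, biprod_fst_lift_apply, ← ModuleCat.comp_apply, biprod.inl_fst] at h1
    exact ⟨c, hc0, h1⟩
  · rintro _ ⟨c, hc, rfl⟩
    have hc' : iB c = 0 := hc
    show (singularHomology.map R M (subsetInclusion inter_subset_left) n ≫
      singularHomology.map R M (subsetIncl A) n) c = 0
    rw [← singularHomology.map_comp, subsetIncl_comp_inter_left_eq, singularHomology.map_comp,
      ModuleCat.comp_apply]
    change singularHomology.map R M (subsetIncl B) n (iB c) = 0
    rw [hc', map_zero]

end Cover

/-! ## §2 Two open subsets `U`, `W` of a space: transport to the inclusions of subsets -/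

section Subsets

variable {X : Type u} [TopologicalSpace X] {U W : Set X}

/-- On homology: `(U ⊆ U ∪ W)_* = e⁻¹_* ≫ (incl_{val⁻¹'U})_*`, `e : val⁻¹'U ≃ₜ U`. [folklore] -/
theorem map_union_left_eq_trace (n : ℕ) :
    singularHomology.map R M (subsetInclusion (subset_union_left : U ⊆ U ∪ W)) n =
      (singularHomology.mapIso R M (preimageValHomeomorphOfSubset
          (subset_union_left : U ⊆ U ∪ W) : ↥(Subtype.val ⁻¹' U : Set ↥(U ∪ W)) ≃ₜ ↥U) n).inv ≫
        singularHomology.map R M (subsetIncl (Subtype.val ⁻¹' U : Set ↥(U ∪ W))) n := by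
  rw [singularHomology.mapIso_inv, ← singularHomology.map_comp]
  rfl

/-- On homology the traces of `U ∩ W ⊆ W`, `U ∩ W ⊆ U` are conjugate to `(U ∩ W ⊆ W)_*`,
`(U ∩ W ⊆ U)_*`. [folklore] -/
theorem map_trace_comm' (n : ℕ) :
    singularHomology.map R M (subsetInclusion (inter_subset_right :
        (Subtype.val ⁻¹' U : Set ↥(U ∪ W)) ∩ Subtype.val ⁻¹' W ⊆ Subtype.val ⁻¹' W)) n ≫
        (singularHomology.mapIso R M (preimageValHomeomorphOfSubset
          (subset_union_right : W ⊆ U ∪ W) : ↥(Subtype.val ⁻¹' W : Set ↥(U ∪ W)) ≃ₜ ↥W) n).hom =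
      (singularHomology.mapIso R M (preimageValHomeomorphOfSubset (A := U ∪ W) (B := U ∩ W)
          (fun _ hx => Or.inl hx.1) : ↥((Subtype.val ⁻¹' U : Set ↥(U ∪ W)) ∩ Subtype.val ⁻¹' W) ≃ₜ ↥(U ∩ W)) n).hom ≫
        singularHomology.map R M (subsetInclusion (inter_subset_right : U ∩ W ⊆ W)) n ∧
    singularHomology.map R M (subsetInclusion (inter_subset_left :
        (Subtype.val ⁻¹' U : Set ↥(U ∪ W)) ∩ Subtype.val ⁻¹' W ⊆ Subtype.val ⁻¹' U)) n ≫
        (singularHomology.mapIso R M (preimageValHomeomorphOfSubset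
          (subset_union_left : U ⊆ U ∪ W) : ↥(Subtype.val ⁻¹' U : Set ↥(U ∪ W)) ≃ₜ ↥U) n).hom =
      (singularHomology.mapIso R M (preimageValHomeomorphOfSubset (A := U ∪ W) (B := U ∩ W)
          (fun _ hx => Or.inl hx.1) : ↥((Subtype.val ⁻¹' U : Set ↥(U ∪ W)) ∩ Subtype.val ⁻¹' W) ≃ₜ ↥(U ∩ W)) n).hom ≫
        singularHomology.map R M (subsetInclusion (inter_subset_left : U ∩ W ⊆ U)) n := by
  constructor <;>
  · rw [singularHomology.mapIso_hom, singularHomology.mapIso_hom, ← singularHomology.map_comp,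
      ← singularHomology.map_comp]
    rfl

/-- Transport of `ker F = i_A (ker i_B)` along conjugating maps. [folklore] -/
theorem ker_eq_map_ker_of_conj {P P' Q I I' B B' : Type*} [AddCommGroup P] [Module R P]
    [AddCommGroup P'] [Module R P'] [AddCommGroup Q] [Module R Q] [AddCommGroup I] [Module R I]
    [AddCommGroup I'] [Module R I'] [AddCommGroup B] [Module R B] [AddCommGroup B'] [Module R B']
    {F : P →ₗ[R] Q} {F' : P' →ₗ[R] Q} {iA : I →ₗ[R] P} {iA' : I' →ₗ[R] P'} {iB : I →ₗ[R] B}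
    {iB' : I' →ₗ[R] B'} (e : P' → P) (he : Function.Surjective e) (eI : I' → I)
    (heI : Function.Surjective eI) (eB : B' → B) (heB : Function.Injective eB) (heB0 : eB 0 = 0)
    (hF : ∀ x', F (e x') = F' x') (hA : ∀ y, e (iA' y) = iA (eI y))
    (hB : ∀ y, eB (iB' y) = iB (eI y))
    (h : LinearMap.ker F' = Submodule.map iA' (LinearMap.ker iB')) :
    LinearMap.ker F = Submodule.map iA (LinearMap.ker iB) := by
  ext a
  simp only [LinearMap.mem_ker, Submodule.mem_map]
  constructor
  · intro ha
    obtain ⟨x', rfl⟩ := he a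
    have hx' : x' ∈ LinearMap.ker F' := by rw [LinearMap.mem_ker, ← hF, ha]
    rw [h] at hx'
    obtain ⟨y, hy, rfl⟩ := hx'
    refine ⟨eI y, ?_, (hA y).symm⟩
    have hy' : iB' y = 0 := hy
    rw [← hB, hy', heB0]
  · rintro ⟨y, hy, rfl⟩
    obtain ⟨y', rfl⟩ := heI y
    have h1 : iB' y' = 0 := heB (by rw [hB, hy, heB0])
    have h2 : iA' y' ∈ LinearMap.ker F' := by rw [h]; exact ⟨y', h1, rfl⟩
    rw [← hA, hF, LinearMap.mem_ker.1 h2]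

/-- Elements: a morphism equation `f ≫ e.hom = g` evaluated. [folklore] -/
theorem apply_eq_of_comp_hom_eq {P Q Q' : ModuleCat.{max u v} R} {f : P ⟶ Q} {g : P ⟶ Q'}
    (e : Q ≅ Q') (h : f ≫ e.hom = g) (x : P) : e.hom (f x) = g x := by rw [← h]; rfl

/-- An isomorphism of `ModuleCat` is a bijection on elements. [folklore] -/
theorem bijective_iso_hom {P Q : ModuleCat.{max u v} R} (e : P ≅ Q) : Function.Bijective e.hom :=
  (ConcreteCategory.isIso_iff_bijective e.hom).1 inferInstance

/-- **`H₁(U) → H₁(U ∪ W)` is onto** for open `U`, `W` with `W`, `U ∩ W` path connected and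
`H₁(U ∩ W) → H₁(W)` onto. [cite: HatcherAT2002, §2.2 p. 149] -/
theorem surjective_map_one_union_of_surjective_right (hU : IsOpen U) (hW : IsOpen W)
    [PathConnectedSpace ↥(U ∩ W)] [PathConnectedSpace ↥W]
    (hs : Function.Surjective
      (singularHomology.map R M (subsetInclusion (inter_subset_right : U ∩ W ⊆ W)) 1)) :
    Function.Surjective
      (singularHomology.map R M (subsetInclusion (subset_union_left : U ⊆ U ∪ W)) 1) := by
  haveI := pathConnectedSpace_trace_inter (U := U) (W := W)
  haveI := pathConnectedSpace_trace_right (U := U) (W := W)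
  haveI := mono_φ_zero R M (Subtype.val ⁻¹' U : Set ↥(U ∪ W)) (Subtype.val ⁻¹' W)
  have hE : Epi (singularHomology.map R M (subsetInclusion (inter_subset_right : U ∩ W ⊆ W)) 1) :=
    (ModuleCat.epi_iff_surjective _).2 hs
  have h2 : Epi ((singularHomology.map R M (subsetInclusion (inter_subset_right :
      (Subtype.val ⁻¹' U : Set ↥(U ∪ W)) ∩ Subtype.val ⁻¹' W ⊆ Subtype.val ⁻¹' W)) 1 ≫
        (singularHomology.mapIso R M (preimageValHomeomorphOfSubset
          (subset_union_right : W ⊆ U ∪ W) : ↥(Subtype.val ⁻¹' W : Set ↥(U ∪ W)) ≃ₜ ↥W) 1).hom) ≫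
      (singularHomology.mapIso R M (preimageValHomeomorphOfSubset
          (subset_union_right : W ⊆ U ∪ W) : ↥(Subtype.val ⁻¹' W : Set ↥(U ∪ W)) ≃ₜ ↥W) 1).inv) := by
    rw [(map_trace_comm' R M 1).1]
    exact epi_comp' (epi_comp' inferInstance hE) inferInstance
  rw [Category.assoc, Iso.hom_inv_id, Category.comp_id] at h2
  have hA : Epi (singularHomology.map R M (subsetIncl (Subtype.val ⁻¹' U : Set ↥(U ∪ W))) 1) :=
    (ModuleCat.epi_iff_surjective _).2 (surjective_map_left_of_surjective R M
      (Subtype.val ⁻¹' U : Set ↥(U ∪ W)) (Subtype.val ⁻¹' W) (interior_union_interior_eq_univ hU hW)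
      0 ((ModuleCat.epi_iff_surjective _).1 h2))
  rw [map_union_left_eq_trace]
  exact (ModuleCat.epi_iff_surjective _).1 (epi_comp' inferInstance hA)

/-- **`ker (Hₙ(U) → Hₙ(U ∪ W)) = i_U (ker (Hₙ(U ∩ W) → Hₙ(W)))`** for open `U`, `W`.
[cite: HatcherAT2002, §2.2 p. 149] -/
theorem ker_map_union_eq_map_ker_right (hU : IsOpen U) (hW : IsOpen W) (n : ℕ) :
    LinearMap.ker (singularHomology.map R M (subsetInclusion (subset_union_left : U ⊆ U ∪ W)) n).hom
      = Submodule.map (singularHomology.map R M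
          (subsetInclusion (inter_subset_left : U ∩ W ⊆ U)) n).hom
          (LinearMap.ker (singularHomology.map R M
            (subsetInclusion (inter_subset_right : U ∩ W ⊆ W)) n).hom) := by
  refine ker_eq_map_ker_of_conj R (fun x => (singularHomology.mapIso R M (preimageValHomeomorphOfSubset
          (subset_union_left : U ⊆ U ∪ W) : ↥(Subtype.val ⁻¹' U : Set ↥(U ∪ W)) ≃ₜ ↥U) n).hom x)
    (bijective_iso_hom R _).2 (fun y => (singularHomology.mapIso R M (preimageValHomeomorphOfSubset (A := U ∪ W) (B := U ∩ W)
          (fun _ hx => Or.inl hx.1) : ↥((Subtype.val ⁻¹' U : Set ↥(U ∪ W)) ∩ Subtype.val ⁻¹' W) ≃ₜ ↥(U ∩ W)) n).hom y)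
    (bijective_iso_hom R _).2 (fun b => (singularHomology.mapIso R M (preimageValHomeomorphOfSubset
          (subset_union_right : W ⊆ U ∪ W) : ↥(Subtype.val ⁻¹' W : Set ↥(U ∪ W)) ≃ₜ ↥W) n).hom b)
    (bijective_iso_hom R _).1 (map_zero _) (fun x' => ?_) (fun y => ?_) (fun y => ?_)
    (ker_map_eq_map_ker_right R M (Subtype.val ⁻¹' U : Set ↥(U ∪ W)) (Subtype.val ⁻¹' W)
      (interior_union_interior_eq_univ hU hW) n)
  · show ((singularHomology.mapIso R M (preimageValHomeomorphOfSubset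
          (subset_union_left : U ⊆ U ∪ W) : ↥(Subtype.val ⁻¹' U : Set ↥(U ∪ W)) ≃ₜ ↥U) n).hom ≫
      singularHomology.map R M (subsetInclusion (subset_union_left : U ⊆ U ∪ W)) n) x' = _
    rw [map_union_left_eq_trace, Iso.hom_inv_id_assoc]
  · erw [apply_eq_of_comp_hom_eq R _ (map_trace_comm' R M (U := U) (W := W) n).2 y]; rfl
  · erw [apply_eq_of_comp_hom_eq R _ (map_trace_comm' R M (U := U) (W := W) n).1 y]; rfl

end Subsets

/-! ## §3 The iterated Mayer–Vietoris steps over finitely many disjoint pieces; the stub -/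

section Pieces

variable {X : Type u} [TopologicalSpace X]

/-- The inclusion of a subset into an equal subset is onto on `H₁` with trivial kernel. [folklore] -/
theorem surjective_and_ker_of_eq {A P : Set X} (hAP : A ⊆ P) (he : P = A) :
    Function.Surjective (singularHomology.map R R (subsetInclusion hAP) 1) ∧
      LinearMap.ker (singularHomology.map R R (subsetInclusion hAP) 1).hom = ⊥ := by
  subst he
  have hid : subsetInclusion hAP = ContinuousMap.id _ := by ext; rfl
  rw [hid, singularHomology.map_id]
  exact ⟨fun y => ⟨y, rfl⟩, LinearMap.ker_eq_bot.2 fun a b h => h⟩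

/-- Equal overlaps feed the same data. [folklore] -/
theorem overlap_congr_set {S T B P : Set X} (hST : S = T) (hSB : S ⊆ B) (hTB : T ⊆ B) (hSP : S ⊆ P)
    (hTP : T ⊆ P) (n : ℕ) :
    (Function.Surjective (singularHomology.map R R (subsetInclusion hSB) n) ↔
      Function.Surjective (singularHomology.map R R (subsetInclusion hTB) n)) ∧
    Submodule.map (singularHomology.map R R (subsetInclusion hSP) n).hom
        (LinearMap.ker (singularHomology.map R R (subsetInclusion hSB) n).hom) =
      Submodule.map (singularHomology.map R R (subsetInclusion hTP) n).hom
        (LinearMap.ker (singularHomology.map R R (subsetInclusion hTB) n).hom) := by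
  subst hST
  exact ⟨Iff.rfl, rfl⟩

variable {ι : Type*} {A : Set X} {B : ι → Set X} {c : ι → singularHomology R R ↥A 1}

/-- **Finset induction over the pieces**: `H₁(A) → H₁(A ∪ ⋃_{i ∈ s} Bᵢ)` is onto with kernel the
span of the `cᵢ`, `i ∈ s`. [cite: HatcherAT2002, §2.2 p. 149] -/
theorem surjective_and_ker_finset_of_surjective_right (hA : IsOpen A) (hB : ∀ i, IsOpen (B i))
    (hdisj : Pairwise fun i j => Disjoint (B i) (B j))
    (hpcI : ∀ i, PathConnectedSpace ↥(A ∩ B i)) (hpcB : ∀ i, PathConnectedSpace ↥(B i))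
    (hsB : ∀ i, Function.Surjective (singularHomology.map R R
      (subsetInclusion (inter_subset_right : A ∩ B i ⊆ B i)) 1))
    (hc : ∀ i, Submodule.map (singularHomology.map R R
      (subsetInclusion (inter_subset_left : A ∩ B i ⊆ A)) 1).hom
      (LinearMap.ker (singularHomology.map R R
        (subsetInclusion (inter_subset_right : A ∩ B i ⊆ B i)) 1).hom) = Submodule.span R {c i})
    (s : Finset ι) : ∀ (P : Set X) (hP : A ⊆ P), P = A ∪ ⋃ i ∈ s, B i →
      Function.Surjective (singularHomology.map R R (subsetInclusion hP) 1) ∧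
      LinearMap.ker (singularHomology.map R R (subsetInclusion hP) 1).hom =
        Submodule.span R (c '' (s : Set ι)) := by
  classical
  induction s using Finset.induction_on with
  | empty =>
    intro P hP hPe
    rw [Finset.coe_empty, image_empty, Submodule.span_empty]
    exact surjective_and_ker_of_eq R hP (by rw [hPe]; simp)
  | @insert i s his ih =>
    intro P hP hPe
    set Q : Set X := A ∪ ⋃ i ∈ s, B i with hQ
    have hAQ : A ⊆ Q := subset_union_left
    obtain rfl : P = Q ∪ B i := by rw [hPe, hQ, Finset.set_biUnion_insert]; ac_rfl
    obtain ⟨hsF, hkF⟩ := ih Q hAQ rfl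
    have hQi : Q ∩ B i = A ∩ B i := by
      rw [hQ, union_inter_distrib_right]
      refine union_eq_left.2 ?_
      rintro a ⟨ha, hai⟩
      obtain ⟨j, hj, haj⟩ := mem_iUnion₂.1 ha
      have hji : j ≠ i := fun e => his (e ▸ hj)
      exact absurd hai (Set.disjoint_left.1 (hdisj hji) haj)
    have hQo : IsOpen Q := hA.union (isOpen_biUnion fun i _ => hB i)
    haveI : PathConnectedSpace ↥(Q ∩ B i) := by rw [hQi]; exact hpcI i
    haveI := hpcB i
    obtain ⟨hsiff, hmapeq⟩ := overlap_congr_set R hQi (inter_subset_right : Q ∩ B i ⊆ B i)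
      (inter_subset_right : A ∩ B i ⊆ B i) (inter_subset_left : Q ∩ B i ⊆ Q)
      (inter_subset_left.trans hAQ : A ∩ B i ⊆ Q) 1
    have hsG := surjective_map_one_union_of_surjective_right R R hQo (hB i) (hsiff.2 (hsB i))
    have hkG' : LinearMap.ker (singularHomology.map R R
        (subsetInclusion (subset_union_left : Q ⊆ Q ∪ B i)) 1).hom =
        Submodule.map (singularHomology.map R R (subsetInclusion hAQ) 1).hom
          (Submodule.span R {c i}) := by
      rw [ker_map_union_eq_map_ker_right R R hQo (hB i) 1, hmapeq,
        hom_map_comp_subsetInclusion R (inter_subset_left : A ∩ B i ⊆ A) hAQ 1,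
        Submodule.map_comp, hc i]
    have hfac : (singularHomology.map R R (subsetInclusion hP) 1).hom =
        (singularHomology.map R R (subsetInclusion (subset_union_left : Q ⊆ Q ∪ B i)) 1).hom ∘ₗ
          (singularHomology.map R R (subsetInclusion hAQ) 1).hom :=
      hom_map_comp_subsetInclusion R hAQ subset_union_left 1
    refine ⟨?_, ?_⟩
    · show Function.Surjective (singularHomology.map R R (subsetInclusion hP) 1).hom
      rw [hfac]; exact hsG.comp hsF
    · rw [hfac, ker_comp_eq_sup hkF hkG', Finset.coe_insert, image_insert_eq, Submodule.span_insert]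

/-- **`H₁` of `X = A ∪ ⋃ᵢ Bᵢ`** (hypotheses as in `stub_Kas_seamMV`): `H₁(A) → H₁(X)` is onto with
kernel `span {cᵢ}` (Kas 1980: `H₁(∂(V ∪ 2-handles)) = H₁(∂V ∖ ⋃ Kᵢ)/⟨longitudes⟩`).
[cite: HatcherAT2002, §2.2 p. 149] -/
theorem surjective_and_ker_cover_of_surjective_right [Finite ι] (hA : IsOpen A)
    (hB : ∀ i, IsOpen (B i)) (hdisj : Pairwise fun i j => Disjoint (B i) (B j))
    (hcov : A ∪ ⋃ i, B i = univ)
    (hpcI : ∀ i, PathConnectedSpace ↥(A ∩ B i)) (hpcB : ∀ i, PathConnectedSpace ↥(B i))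
    (hsB : ∀ i, Function.Surjective (singularHomology.map R R
      (subsetInclusion (inter_subset_right : A ∩ B i ⊆ B i)) 1))
    (hc : ∀ i, Submodule.map (singularHomology.map R R
      (subsetInclusion (inter_subset_left : A ∩ B i ⊆ A)) 1).hom
      (LinearMap.ker (singularHomology.map R R
        (subsetInclusion (inter_subset_right : A ∩ B i ⊆ B i)) 1).hom) = Submodule.span R {c i}) :
    Function.Surjective (singularHomology.map R R (subsetIncl A) 1) ∧
      LinearMap.ker (singularHomology.map R R (subsetIncl A) 1).hom =
        Submodule.span R (range c) := by
  haveI := Fintype.ofFinite ι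
  have hcov' : (univ : Set X) = A ∪ ⋃ i ∈ (Finset.univ : Finset ι), B i := by
    rw [← hcov]; congr 1; ext x; simp
  obtain ⟨hs, hk⟩ := surjective_and_ker_finset_of_surjective_right R hA hB hdisj hpcI hpcB hsB hc
    Finset.univ univ (subset_univ A) hcov'
  rw [Finset.coe_univ, image_univ] at hk
  obtain ⟨hsu, hku⟩ := surjective_and_ker_univ R (X := X) 1
  have hfac : (singularHomology.map R R (subsetIncl A) 1).hom =
      (singularHomology.map R R (subsetIncl (univ : Set X)) 1).hom ∘ₗ
        (singularHomology.map R R (subsetInclusion (subset_univ A)) 1).hom := by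
    rw [← ModuleCat.hom_comp, ← singularHomology.map_comp]; rfl
  refine ⟨?_, by rw [hfac, LinearMap.ker_comp_of_ker_eq_bot _ hku, hk]⟩
  show Function.Surjective (singularHomology.map R R (subsetIncl A) 1).hom
  rw [hfac]; exact hsu.comp hs

end Pieces

/-- **Mayer–Vietoris half of Kas' seam quotient** (registered sub-goal stub `stub_Kas_seamMV` of
`stub_modelsOn_counts`, design lemma (D) `Kas_seam_quotient`): for `X = A ∪ ⋃ᵢ Bᵢ` (`A`, `Bᵢ` open,
the `Bᵢ` pairwise disjoint and path connected, the `A ∩ Bᵢ` path connected, `H₁(A ∩ Bᵢ) → H₁(Bᵢ)`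
onto with the image in `H₁(A)` of its kernel `= R ∙ cᵢ`), `H₁(A) → H₁(X)` is onto with kernel
`span {cᵢ}` (for the cover `∂X = U ∪ ⋃ Wᵢ`, `Wᵢ ≅ S³ ∖ S`, `U ∩ Wᵢ ≅ T² × ℝ`, of the boundary of
a multi-attachment of 2-handles: Kas' `H₁(∂X) = H₁(∂V ∖ ⋃ Kᵢ)/⟨ℓᵢ⟩`). [cite: HatcherAT2002, §2.2 p. 149] -/
theorem stub_Kas_seamMV : ∀ (R : Type) [CommRing R] (X : Type) [TopologicalSpace X]
    (ι : Type) [Finite ι] (A : Set X) (B : ι → Set X)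
    (c : ι → Literature.AlgebraicTopology.SingularHomology.singularHomology R R ↥A 1),
    IsOpen A → (∀ i, IsOpen (B i)) → Pairwise (fun i j => Disjoint (B i) (B j)) →
    A ∪ (⋃ i, B i) = Set.univ → (∀ i, PathConnectedSpace ↥(A ∩ B i)) →
    (∀ i, PathConnectedSpace ↥(B i)) →
    (∀ i, Function.Surjective (Literature.AlgebraicTopology.SingularHomology.singularHomology.map R R
      (Literature.AlgebraicTopology.SingularHomology.subsetInclusion
        (Set.inter_subset_right : A ∩ B i ⊆ B i)) 1)) →
    (∀ i, Submodule.map (Literature.AlgebraicTopology.SingularHomology.singularHomology.map R R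
      (Literature.AlgebraicTopology.SingularHomology.subsetInclusion
        (Set.inter_subset_left : A ∩ B i ⊆ A)) 1).hom
      (LinearMap.ker (Literature.AlgebraicTopology.SingularHomology.singularHomology.map R R
        (Literature.AlgebraicTopology.SingularHomology.subsetInclusion
          (Set.inter_subset_right : A ∩ B i ⊆ B i)) 1).hom) = Submodule.span R {c i}) →
    Function.Surjective (Literature.AlgebraicTopology.SingularHomology.singularHomology.map R R
      (Literature.AlgebraicTopology.SingularHomology.subsetIncl A) 1) ∧
    LinearMap.ker (Literature.AlgebraicTopology.SingularHomology.singularHomology.map R R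
      (Literature.AlgebraicTopology.SingularHomology.subsetIncl A) 1).hom =
      Submodule.span R (Set.range c) :=
  fun R _ _ _ _ _ _ _ _ hA hB hdisj hcov hpcI hpcB hsB hc =>
    surjective_and_ker_cover_of_surjective_right R hA hB hdisj hcov hpcI hpcB hsB hc

end Summit.SmoothPoincare4.SmoothPoincare4.Theorems.AcyclicBisectionExists.ModpBraidOrbits
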